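import Summits.HubbardSuperconductivity.HubbardSuperconductivity.Theses.InfiniteVolumeFirst

/-!
# Route `InfiniteVolumeFirst` — assembly item `Assembly` (stmt-HubbardSuperconductivity-18536)

`InfiniteVolumeFirst.Assembly` (Theses/InfiniteVolumeFirst.lean rev 0) is the curried implication
`NoNormalLimitState → NoInfraredPileUp → TightnessExchange → HubbardSuperconductivity`
from the route's items to the summit statement `HubbardSuperconductivity`. It is, binder for
binder, the type of the route file's DECIDING THEOREM `InfiniteVolumeFirst.closes`
(planner-authored glue, elaborated with the route file): take `δ` from `NoNormalLimitState`;
`NoInfraredPileUp` at `δ` gives `U₁`; `NoNormalLimitState` at `U₀ := U₁` gives `U ∈ (0, U₁)` and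
the atom property of every admissible family; for an admissible `(N, ψ)` apply
`TightnessExchange` to `ψ` with the normalisation clause, the window-tail bound from
`NoInfraredPileUp` and the atom property — its conclusion is literally the summit's
`HasLongRangeOrder` clause. This file closes the assembly item BY NAME with that glue — the
theorem below has type literally
`Summit.HubbardSuperconductivity.HubbardSuperconductivity.Theses.InfiniteVolumeFirst.Assembly`
and its proof term is `InfiniteVolumeFirst.closes`. Pure logic over the route's own
declarations: no analysis, no new definitions, no restatement of any item.

Source for the order parameter / summit matrix being assembled: D. J. Scalapino, Phys. Rep. 250
(1995) 329, §2; the torus ground-state LRO format follows T. Koma and H. Tasaki, J. Stat. Phys.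
76 (1994) 745.
-/

-- the mandated namespace `Summit.<Summit>.<Problem>.Theorems` repeats `HubbardSuperconductivity`
-- (single-problem summit, D-0017), which the `dupNamespace` linter flags on every declaration
set_option linter.dupNamespace false

namespace Summit.HubbardSuperconductivity.HubbardSuperconductivity.Theorems

/-- **Assembly of route `InfiniteVolumeFirst`** (item `stmt-HubbardSuperconductivity-18536`):
`NoNormalLimitState → NoInfraredPileUp → TightnessExchange → HubbardSuperconductivity`.
The route's deciding theorem `InfiniteVolumeFirst.closes` takes the three items as named
hypotheses and concludes the sub-problem statement; read as a closed implication it is exactly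
`InfiniteVolumeFirst.Assembly`, so the item is closed by the planner's certified glue itself.
[folklore] -/
theorem infiniteVolumeFirst_assembly_proof :
    Summit.HubbardSuperconductivity.HubbardSuperconductivity.Theses.InfiniteVolumeFirst.Assembly :=
  Summit.HubbardSuperconductivity.HubbardSuperconductivity.Theses.InfiniteVolumeFirst.closes

end Summit.HubbardSuperconductivity.HubbardSuperconductivity.Theorems
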